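import Mathlib
import HarnessLib
import HarnessLib.Audit
import Summits.KontsevichZagierPeriods.Statement
import HarnessLib.Audit.Status.Attr

/-!
Route: RootDecompDescentLadder

# Route RootDecompDescentLadder — root decomposition A (lens-1 DescentLadder) — KZ splits exactly
into planar areas, weight-two descent to areas, descent to dimension two

It suffices to show three RELATIVE rungs of the (dimension, integrand-class) ladder of the KZ
calculus:
X = PlanarAreas ∧ AreaDescentTwo ∧ KernelDescentTwo. PlanarAreas (rung 1 = areas of planar
ℚ-semialgebraic
sets = real 1-periods; verbatim item stmt-KontsevichZagierPeriods-4990) resolves equal-area pairs by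
moves;
AreaDescentTwo (relative rung 2 = weight ≤ 2 modulo weight ≤ 1) transports every equal-valued pair
of
KZ-rational representations of dimensions ≤ 2, modulo the moves, to an equal-area pair of planar
sets;
KernelDescentTwo (declared residual = weight ≥ 3 modulo weight ≤ 2) transports every equal-valued
KZ-rational
pair, modulo the moves, to an equal-valued KZ-rational pair of dimensions ≤ 2. The split is exact
(`summit_iff_split : KontsevichZagierPeriods ↔ X`, kernel-checked in the draft file, 0 sorry) and is
the root
node of the decomposition cell decomp-kz, lens «grading / quantitative ladder».
ROOT DECOMPOSITION CELL decomp-kz (D-0178), generation 0, node A = lens-1 «DescentLadder» v1 (NODE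
2026-08-30T01:17:42Z; kernel file HOME/decomp-kz-lens-1/DescentLadder.lean sha256
66c5f0813a3b3b46f50f38f2b88984b37c28aefc52affb616c64712b87b2e29e: `closes`, `summit_iff_split`, the
three `_of_summit` necessity theorems and the costume census, rc 0, 0 sorry, std axioms), CLEARED by
the critic decomp-kz-crit-1 2026-08-30T01:20:03Z as an AND-node with a declared residual (kernel
identity recorded by the critic: PlanarAreas ∧ AreaDescentTwo ⟺ KZ_leRat 2, node ⟺ the rational
dimension ladder cut at d = 2 with the rung split; HOME/CRITIC-LEDGER.md,
HOME/critic/L1_DescentLadder_v1_probe.lean); filed by the cell writer decomp-kz-writer-1 (native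
`closes` certification rc 0, BC2 C → S probes FAIL 3/3, BC7 3/3 CLEAN, tribunal pre-check --full
tk=PROVISIONAL with residual := KernelDescentTwo). Tags: P1 PlanarAreas
WEAKER·ATTACKABLE+INSTRUMENTABLE (= item stmt-KontsevichZagierPeriods-4990, shared) · P2
AreaDescentTwo WEAKER·IDEA-NEEDED+INSTRUMENTABLE · P3 KernelDescentTwo DECLARED-RESIDUAL(KZ_leRat
2)·IDEA-NEEDED. No EQUIV layer is used as an item (the exactness `summit_iff_split` is a record in
the lens file). Census data: none yet (HOME/census/ empty at filing; instruments I1/I2 specified in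
the lens NODE.md). WHY THIS IS NOVEL: the first finite exact conjunction for this summit made of
RELATIVE rungs (kernel descents modulo the move group) rather than absolute nested rungs
(Theorems/KzOnePeriodsLadder, S ⟺ ∀ d KZ_le d) or sector ∧ complement (complement ≡ S), with the
costume boundary proved (descent ≡ S iff the rung below is a theorem). Rung currency: rung 0 —
nothing here proves the summit.
Lean:
`Summit.KontsevichZagierPeriods.KontsevichZagierPeriods.Theses.RootDecompDescentLadder.PlanarAreas ∧
Summit.KontsevichZagierPeriods.KontsevichZagierPeriods.Theses.RootDecompDescentLadder.AreaDescentTwo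
∧
Summit.KontsevichZagierPeriods.KontsevichZagierPeriods.Theses.RootDecompDescentLadder.KernelDescentTwo`

## Assembly
Pure additive-subgroup algebra in `KZ.relations`: given a rational equal-valued pair (r, r'),
KernelDescentTwo
gives [r]−[r'] ≡ [s]−[s'] with s, s' rational of dimensions ≤ 2 and equal values; AreaDescentTwo
gives
[s]−[s'] ≡ [A]−[A'] with A, A' planar of equal area; PlanarAreas gives [A]−[A'] ∈ relations; add
(deciding
theorem `closes` in glue.lean, 9 lines; the draft file also proves the converse `summit_iff_split`).

Rationale: WHY THIS LINE. The tree's dimension ladder `S ↔ ∀ d, KZ_le d` (Theorems/KzOnePeriodsLadder,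
KontsevichZagier2001 §1.2 Problem 2)
is nested — `KZ_le (d+1) → KZ_le d` by the dummy-variable lift — so no finite set of rungs assembles
to S, and
the complement of a rung is ≡ S by the rational graph lift (`complementAbove_iff_summit`, proved in
the draft).
Replacing complements by DESCENTS modulo the move group gives, for every sub-world W, an exact split
S ↔ Z(W) ∧ Desc(W) whose descent half is ≡ S exactly when the rung Z(W) is a theorem
(`kernelDescentTo_iff_summit_of_rung`; with Baker's rung `KZ_leRat 1` = LowdimBaker0DimLeOne PROVED
this kills
every cut below dimension 2), so the honest cut points are the unproved rungs and the node cuts at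
the two
lowest: rung 1 = 1-periods, where the value-level theory is complete (HuberWustholz2022 Thm 13.3
(2), only
transcendence input the analytic subgroup theorem; equality of 1-periods computable,
arXiv:2505.20397) and the
tree already closes PlanarAreas conditionally on the named fact `HuberWustholzCurvePeriods`;
relative rung 2 =
quadratic forms in logarithms / dilogarithms, the first grade with no value-level theorem
(HuberWustholz2022
Rem. 13.2 (3): 𝒫¹ is not closed under multiplication; Bertolin2002; tree
`KzOnePeriods.Dim2.PiLogTwoWeightLeTwoIndependent`)
and with the catalogued move-side obstruction (Ayoub2015 Rem. 1.2, AlgebraicPrimitivesObstruction: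
the
one-variable primitive of p/q leaves the semialgebraic world exactly at a non-zero residue, i.e. at
weight 2).
Imported: transcendence of 1-motives (Wüstholz) for rung 1; nothing for the residual, which is
labelled as such.

RANKED CRUXES. #2 AreaDescentTwo (crux) — [ROOT-DECOMP decomp-kz gen 0 · node A piece P2 · tag
WEAKER — S ⟹ P2 by `areaDescentTwo_of_summit` (empty planar witnesses;
HOME/decomp-kz-lens-1/DescentLadder.lean sha256
66c5f0813a3b3b46f50f38f2b88984b37c28aefc52affb616c64712b87b2e29e); P2 ⟹ S NOT known: kernel sandwich
KZ_leRat 2 ⟹ P2 ⟹ (PlanarAreas → KZ_leRat 2) and P1 ∧ P2 ⟺ KZ_leRat 2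
(`critic_p1_and_p2_iff_ratRung`), BC2 probe P2 → S FAILS · NECESSARY (binder h₂ of `closes`) · leaf
IDEA-NEEDED + INSTRUMENTABLE (census instrument I2 = weight-2 identity census; no census data file
yet: HOME/census/ empty at filing) · the lens-claimed BARRIER placement
(AlgebraicPrimitivesObstruction, GPC weight-2 slice) is NOT certified by the critic as typed ·
verdict: critic decomp-kz-crit-1 CLEARED 2026-08-30T01:20:03Z (HOME/CRITIC-LEDGER.md row «lens-1
DescentLadder v1»; probe HOME/critic/L1_DescentLadder_v1_probe.lean rc 0, std axioms)] any two
KZ-rational integral representations of dimensions ≤ 2 with equal values differ, modulo the KZ move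
group, from a pair of planar ℚ-semialgebraic sets (dimension-2 representations with integrand 1) of
equal area (piece P2, relative rung 2: weight ≤ 2 modulo weight ≤ 1; S ⟹ it with the empty planar
set as witness, `areaDescentTwo_of_summit`). [difficulty: open-problem] (why it might fail: it
cannot fail without KZ failing (S ⟹ it, kernel); as a target it contains every ℚ̄-relation among Li₂
values and products of two logarithms — Zagier's dilogarithm conjecture (item 10550) and π·log 2 ∉ ℚ
are open.) [KontsevichZagier2001, HuberWustholz2022, Bertolin2002, Ayoub2015]
#3 PlanarAreas (crux) — [ROOT-DECOMP decomp-kz gen 0 · node A piece P1 · tag WEAKER — S ⟹ P1 by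
`planarAreas_of_summit` (HOME/decomp-kz-lens-1/DescentLadder.lean sha256
66c5f0813a3b3b46f50f38f2b88984b37c28aefc52affb616c64712b87b2e29e); P1 ⟹ S NOT known (real 1-periods
only), BC2 probe P1 → S FAILS · NECESSARY (binder h₁) · = item stmt-KontsevichZagierPeriods-4990
VERBATIM (shared, critic w1) · leaf ATTACKABLE (closed modulo print: HuberWustholz2022 Thm 13.3 (2)
via the tree's conditional closing `KzOnePeriods.planarAreas_of_huberWustholzCurvePeriods`; rational
sub-rung KZ_leRat 1 PROVED, Baker) + INSTRUMENTABLE (census instrument I1 = certified equal-area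
pairs, isogeny degree ↦ move-chain length; no census data file yet) · verdict: critic
decomp-kz-crit-1 CLEARED 2026-08-30T01:20:03Z (HOME/CRITIC-LEDGER.md row «lens-1 DescentLadder v1»;
probe HOME/critic/L1_DescentLadder_v1_probe.lean rc 0, std axioms)] two planar ℚ-semialgebraic sets
of equal finite area (dimension-2 representations with integrand 1 on the domain and equal values)
are KZ-equivalent (piece P1, rung 1 = the real 1-period sector; verbatim the open item
LowDimension.PlanarAreas stmt-KontsevichZagierPeriods-4990; S ⟹ it, `planarAreas_of_summit`; closed
in the tree CONDITIONALLY on the named fact HuberWustholzCurvePeriods by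
KzOnePeriods.planarAreas_of_huberWustholzCurvePeriods). [difficulty: XL] (why it might fail: cannot
fail without KZ failing; as a target, an equal-area pair whose Huber–Wüstholz relation runs through
a correspondence of curves of high degree may admit no semialgebraic scissors realisation the tree's
compiler reaches.) [KontsevichZagier2001, HuberWustholz2022, arXiv:2505.20397, arXiv:1805.10104]
#4 KernelDescentTwo (crux) — [ROOT-DECOMP decomp-kz gen 0 · node A piece P3 · tag
DECLARED-RESIDUAL(KZ_leRat 2) — S ⟹ P3 by `kernelDescentTwo_of_summit`
(HOME/decomp-kz-lens-1/DescentLadder.lean sha256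
66c5f0813a3b3b46f50f38f2b88984b37c28aefc52affb616c64712b87b2e29e); P3 ⟹ (KZ_leRat 2 → S)
(`critic_p3_imp_residual`) and P3 ≡ S the day KZ_leRat 2 is proved
(`kernelDescentTo_iff_summit_of_rung`); P3 ⟹ S NOT known today, BC2 probe FAILS; a LABEL, never
WEAKER-by-evidence; tribunal role = residual (tribunal_fit) · NECESSARY (binder h₃) · leaf
IDEA-NEEDED (no descent mechanism beyond Fubini/Stokes known) · cell score for gen 1 = shrink this
residual · verdict: critic decomp-kz-crit-1 CLEARED 2026-08-30T01:20:03Z (HOME/CRITIC-LEDGER.md row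
«lens-1 DescentLadder v1»; probe HOME/critic/L1_DescentLadder_v1_probe.lean rc 0, std axioms)] any
two KZ-rational integral representations (any dimensions) with equal values differ, modulo the KZ
move group, from a pair of KZ-rational representations of dimensions ≤ 2 with equal values (piece
P3, DECLARED-RESIDUAL = weight ≥ 3 modulo weight ≤ 2; S ⟹ it with the empty representation as
witness, `kernelDescentTwo_of_summit`; strictly stronger than the bare implication KZ_leRat 2 → S,
and ≡ S the day KZ_leRat 2 is proved, `kernelDescentTo_iff_summit_of_rung`). [difficulty:
open-problem] (why it might fail: cannot fail without KZ failing; as a target it contains Conjecture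
1 for ζ(3), ζ(5), … up to weight-2 corrections, and no descent mechanism beyond Fubini/Stokes in a
bounded number of variables is known (AlgebraicPrimitivesObstruction).) [KontsevichZagier2001,
Ayoub2015, CressonViusos2022]

TWO-LAYER PLAN. PlanarAreas ⇐ (HuberWustholzCurvePeriods rendered as a theorem) → PlanarAreas is
already the tree's conditional
closing (KzOnePeriods.planarAreas_of_huberWustholzCurvePeriods); foreseen split of AreaDescentTwo
into
«residue-free dimension-2 rational representations descend by ONE Newton–Leibniz move» (KZ-degree ≤
1, decided by
rung 1: KzOnePeriodsDim2Descent.equivalent_of_value_eq_of_degree_le_one) and «the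
logarithmic-residue sector»
(genuine weight 2: dilogarithm functional equations as move chains, FiveTermTransfer /
EulerFormChain in the tree);
KernelDescentTwo ⇐ KernelDescentTo 3 ∧ (descent 3 → 2) is the next rung if ever wanted. Nothing
filed now.

KILL CRITERIA. No piece is refutable without refuting KZ (each is a kernel consequence of S:
`planarAreas_of_summit`,
`areaDescentTwo_of_summit`, `kernelDescentTwo_of_summit`). The route is retired `superseded` if a
route proves
KZ_leRat 2 outright (then KernelDescentTwo ≡ S by `kernelDescentTo_iff_summit_of_rung` and the node
degenerates
to the ladder's next cut), and re-cut one rung higher in that case.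

NOT DECOMPOSED YET. The weight-2 sector's internal structure (products of 1-periods vs. dilogarithms
vs. mixed elliptic weight 2),
the exact move-length currency of rung 1 (isogeny degree ↦ chain length, DimensionBudget's
relationsLE),
and every rung ≥ 3 — layer-2 children or later generations of the cell.

CHEAPEST FALSIFIER. Costume probes (run, bc/probes.lean on the farm, rc 1 with exactly the 9
expected failures): `PlanarAreas → S`,
`AreaDescentTwo → S`, `KernelDescentTwo → S`, each PAIR → S, and each piece outright all FAIL under
exact? | simpa | aesop; BC7 `#h21_crux_probe` 3/3 CLEAN. The one lookup that would kill the NODE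
(not KZ): a tree
theorem proving KZ_leRat 2 (none: `lean search KZ_leRat` gives only KZ_leRat 1 = Baker and
monotonicity).

NUMBERS. Rungs proved: KZ_le 0 (LowdimDimZero), KZ_leRat 1 (Baker, LowdimBaker0DimLeOne); KZ_le 1
and PlanarAreas
conditional on HuberWustholzCurvePeriods (KzOnePeriodsRungOneOfHW). First open value-level
statements at weight 2:
ℚ-independence of 1, π, log 2, π², π·log 2, (log 2)² (PiLogTwoWeightLeTwoIndependent); no
homogeneous quadratic
relation among log 2, log 3, log 5 (TernaryQuadraticLogIndependent); decided contrast: two logs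
(binaryQuadratic_log_independent).

DEFINITION REQUESTS. None: every constant exists (KZ.IntegralRep, IsRational, value, of, relations,
Equivalent; IntegralRep.empty,
graphRep for the witnesses).

Novelty: Searches (2026-08-30): lit search --hybrid "Huber Wüstholz period conjecture 1-motives dimension one
periods linear relations" (6 docs; book:huber2022-transcendence-linear-relations-1-periods pp 121,
18 confirmed by lit read --grep: Thm 13.3 (2), Rem. 13.2 (3)); lit search "decidable equality
periods Ouaknine Worrell" (remote: arXiv:2505.20397 Sertöz–Ouaknine–Worrell 2025); lit galaxy search
"Kontsevich-Zagier|period conjecture|dilogarithm conjecture" --star pdf (6 rows, 0 on a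
descent/ladder decomposition); tree: rg KZ_le / KernelDescent / Desc in Theorems
(KzOnePeriodsLadder, KzOnePeriodsDim2Descent, KzOnePeriodsGaps, HodgeColevel*Strength,
DimensionBudget) — no descent-modulo-moves piece typed anywhere; ledger negatives (1 entry,
KinematicPlaneConvex, unrelated).
Nearest prior art found: tree Theorems/KzOnePeriodsLadder (`summit_iff_forall_KZ_le`, nested
infinite ladder) and Theorems/KzOnePeriodsDim2Descent (descent CLASS of KZ-degree ≤ 1 decided by
rung 1; weight-2 stops typed) [tree]; HuberWustholz2022 Thm 13.3
[corpus:book:huber2022-transcendence-linear-relations-1-periods p.121]; KontsevichZagier2001 §1.2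
Problem 2.
Delta: the ladder's rungs are absolute and nested (their finite conjunctions never reach S, their
complements are ≡ S); this line makes the rungs RELATIVE (descent of the kernel modulo the move
group), which yields the first finite exact conjunction of pairwise-incomparable strictly-weaker
pieces for this summit and a proved costume boundary locating the ad  [refs: 2505.20397, book:huber2022-transcendence-linear-relations-1-periods, HuberWustholz2022, KontsevichZagier2001]

Barriers (technique_class: dimension-ladder, kernel-descent, one-periods, scissors-moves): - technique_class: dimension-ladder, kernel-descent, one-periods, scissors-moves
- Literature.Barriers.KontsevichZagierPeriods.noSemialgebraicPrimitive_inv_sub_two: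
(AlgebraicPrimitivesObstruction, with algebraicPrimitivesObstructionNarrow) PlanarAreas and both
descents conclude `∈ KZ.relations` (moves through ALL dimensions), never relationsLE d, so no piece
asserts fixed-variable Stokes generation; the barrier is where AreaDescentTwo's difficulty lives
(residues), named as its leaf tag, not evaded.
- Literature.Barriers.KontsevichZagierPeriods.kzConjecture_implies_oddZetaAlgIndep:
(GrothendieckPeriodConjectureDependence, with kzConjecture_implies_twoPiI_log_algIndep and
kzConjecture_implies_ellipticPeriods_algIndep) rung 1 sits below it (1-motives, Wüstholz);
AreaDescentTwo and KernelDescentTwo do not evade it — the bet is only that the weight-2 slice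
(Bertolin's 1-motive GPC, dilogarithm conjecture) is the smallest open instance and is
instrumentable by an identity census.
- Literature.Barriers.KontsevichZagierPeriods.cressonViuSos_prop_3_2: (HauptvermutungObstruction) no
global scissors-free comparison map is posited; descents are existential statements about the move
group.
- Literature.Barriers.KontsevichZagierPeriods.not_complete_of_undecidable:
(PeriodEqualityDecidability, with not_complete_of_undecidableNarrow) not touched (no
completeness/decidability claim); for rung 1 equality IS computable (arXiv:2505.20397), which is
what makes it instrumentable.
- Negatives ind

sub-problem: KontsevichZagierPeriods · status: open · opened planner-decomp-kz-writer-1-g0-0 2026-08-30T01:26:17Z · rev 0 · ledger route-KontsevichZagierPeriods-RootDecompDescentLadder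
GENERATED by the gate from the ledger (D-0016/17). Provers cite these decls: `theorem foo : Summit.KontsevichZagierPeriods.KontsevichZagierPeriods.Theses.RootDecompDescentLadder.<Decl> := …` in Summits/KontsevichZagierPeriods/KontsevichZagierPeriods/Theorems/<Name>.lean.
-/

namespace Summit.KontsevichZagierPeriods.KontsevichZagierPeriods.Theses.RootDecompDescentLadder

open scoped BigOperators Topology Manifold Classical MeasureTheory ProbabilityTheory Matrix InnerProductSpace ComplexConjugate ContinuousMap
open Filter Set Function TopologicalSpace MeasureTheory

attribute [summit_statement] _root_.KontsevichZagierPeriods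

open Literature Periods

/-- item stmt-KontsevichZagierPeriods-23648 · crux · rank 2 · open · by planner
why it might fail: it cannot fail without KZ failing (S ⟹ it, kernel); as a target it contains every ℚ̄-relation among Li₂ values and products of two logarithms — Zagier's dilogarithm conjecture (item 10550) and π·log 2 ∉ ℚ are open.
sources: KontsevichZagier2001, HuberWustholz2022, Bertolin2002, Ayoub2015
[crux] [ROOT-DECOMP decomp-kz gen 0 · node A piece P2 · tag WEAKER — S ⟹ P2 by
`areaDescentTwo_of_summit` (empty planar witnesses; HOME/decomp-kz-lens-1/DescentLadder.lean sha256
66c5f0813a3b3b46f50f38f2b88984b37c28aefc52affb616c64712b87b2e29e); P2 ⟹ S NOT known: kernel sandwich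
KZ_leRat 2 ⟹ P2 ⟹ (PlanarAreas → KZ_leRat 2) and P1 ∧ P2 ⟺ KZ_leRat 2
(`critic_p1_and_p2_iff_ratRung`), BC2 probe P2 → S FAILS · NECESSARY (binder h₂ of `closes`) · leaf
IDEA-NEEDED + INSTRUMENTABLE (census instrument I2 = weight-2 identity census; no census data file
yet: HOME/census/ empty at filing) · the lens-claimed BARRIER placement
(AlgebraicPrimitivesObstruction, GPC weight-2 slice) is NOT certified by the critic as typed ·
verdict: critic decomp-kz-crit-1 CLEARED 2026-08-30T01:20:03Z (HOME/CRITIC-LEDGER.md row «lens-1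
DescentLadder v1»; probe HOME/critic/L1_DescentLadder_v1_probe.lean rc 0, std axioms)] any two
KZ-rational integral representations of dimensions ≤ 2 with equal values differ, modulo the KZ move
group, from a pair of planar ℚ-semialgebraic sets (dimension-2 representations with integrand 1) of
equal area (piece P2, relative rung 2: weight ≤ 2 modulo weight ≤ 1; S ⟹ it with the empty p -/
@[route_item "route-KontsevichZagierPeriods-RootDecompDescentLadder", crux]
def AreaDescentTwo : Prop :=
  ∀ ⦃n m : ℕ⦄, n ≤ 2 → m ≤ 2 → ∀ (r : Literature.NumberTheory.Transcendental.KZ.IntegralRep n) (r' : Literature.NumberTheory.Transcendental.KZ.IntegralRep m), r.IsRational → r'.IsRational → r.value = r'.value → ∃ A A' : Literature.NumberTheory.Transcendental.KZ.IntegralRep 2, (∀ p ∈ A.domain, A.integrand p = 1) ∧ (∀ p ∈ A'.domain, A'.integrand p = 1) ∧ A.value = A'.value ∧ Literature.NumberTheory.Transcendental.KZ.of r - Literature.NumberTheory.Transcendental.KZ.of r' - (Literature.NumberTheory.Transcendental.KZ.of A - Literature.NumberTheory.Transcendental.KZ.of A') ∈ Literature.NumberTheory.Transcendental.KZ.rel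ations

/-- item stmt-KontsevichZagierPeriods-4990 · crux · rank 3 · open · by planner
why it might fail: cannot fail without KZ failing; as a target, an equal-area pair whose Huber–Wüstholz relation runs through a correspondence of curves of high degree may admit no semialgebraic scissors realisation the tree's compiler reaches.
sources: KontsevichZagier2001, HuberWustholz2022, arXiv:2505.20397, arXiv:1805.10104
[crux] curved planar Hilbert III over ℚ̄ inside the rules (card (B)(ii), depth 1 of the layer): two
2-dim representations with integrand 1 — i.e. two ℚ-semialgebraic planar sets of finite area — with
the same area are KZ-equivalent. Areas of planar ℚ-semialgebraic sets are exactly the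
(ℚ̄∩ℝ)-combinations of real 1-periods ∫ (ψ − φ) dx over algebraic arcs (Newton–Leibniz along y with
primitive y, and back by subgraphs), so this is Huber–Wüstholz's theorem 'all ℚ̄-linear relations
among 1-periods come from bilinearity and functoriality of pairs (C, D)' (Thm 13.3) TRANSFERRED:
every such relation — isogenies and correspondences between curves, Cauchy/residue relations among
real ovals, exact algebraic forms — must be a chain of real semialgebraic moves. Equality of two
such areas is decidable today (SertozOuaknineWorrell2025); the claim is that it is derivable. Shares
its 1-dim content with LowDimension items 0117/0510 (informal, definition-blocked) and its elliptic
sectors with HermiteRigidity. [difficulty: XL] -/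
@[route_item "route-KontsevichZagierPeriods-RootDecompDescentLadder", crux]
def PlanarAreas : Prop :=
  ∀ (r r' : Literature.NumberTheory.Transcendental.KZ.IntegralRep 2), (∀ p ∈ r.domain, r.integrand p = 1) → (∀ p ∈ r'.domain, r'.integrand p = 1) → r.value = r'.value → Literature.NumberTheory.Transcendental.KZ.Equivalent r r'

/-- item stmt-KontsevichZagierPeriods-23649 · crux · rank 4 · open · by planner
why it might fail: cannot fail without KZ failing; as a target it contains Conjecture 1 for ζ(3), ζ(5), … up to weight-2 corrections, and no descent mechanism beyond Fubini/Stokes in a bounded number of variables is known (AlgebraicPrimitivesObstruction).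
sources: KontsevichZagier2001, Ayoub2015, CressonViusos2022
[crux] [ROOT-DECOMP decomp-kz gen 0 · node A piece P3 · tag DECLARED-RESIDUAL(KZ_leRat 2) — S ⟹ P3
by `kernelDescentTwo_of_summit` (HOME/decomp-kz-lens-1/DescentLadder.lean sha256
66c5f0813a3b3b46f50f38f2b88984b37c28aefc52affb616c64712b87b2e29e); P3 ⟹ (KZ_leRat 2 → S)
(`critic_p3_imp_residual`) and P3 ≡ S the day KZ_leRat 2 is proved
(`kernelDescentTo_iff_summit_of_rung`); P3 ⟹ S NOT known today, BC2 probe FAILS; a LABEL, never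
WEAKER-by-evidence; tribunal role = residual (tribunal_fit) · NECESSARY (binder h₃) · leaf
IDEA-NEEDED (no descent mechanism beyond Fubini/Stokes known) · cell score for gen 1 = shrink this
residual · verdict: critic decomp-kz-crit-1 CLEARED 2026-08-30T01:20:03Z (HOME/CRITIC-LEDGER.md row
«lens-1 DescentLadder v1»; probe HOME/critic/L1_DescentLadder_v1_probe.lean rc 0, std axioms)] any
two KZ-rational integral representations (any dimensions) with equal values differ, modulo the KZ
move group, from a pair of KZ-rational representations of dimensions ≤ 2 with equal values (piece
P3, DECLARED-RESIDUAL = weight ≥ 3 modulo weight ≤ 2; S ⟹ it with the empty representation as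
witness, `kernelDescentTwo_of_summit`; strictly stronger than the bare implication KZ_leR -/
@[route_item "route-KontsevichZagierPeriods-RootDecompDescentLadder", crux (bottleneck := work) (experiment := "instrument: R·ATTACKABLE; sub-layer KZ_leRat 1 PROVED] ∧ AreaDescentTwo 23648 [IDEA-NEEDED + INSTRUMENTABLE; weight-2 box 50/50 kernel-decided, `pair18…") (source := "director FRONTIER l.68, 2026-09-01")]
def KernelDescentTwo : Prop :=
  ∀ ⦃n m : ℕ⦄ (r : Literature.NumberTheory.Transcendental.KZ.IntegralRep n) (r' : Literature.NumberTheory.Transcendental.KZ.IntegralRep m), r.IsRational → r'.IsRational → r.value = r'.value → ∃ k l : ℕ, k ≤ 2 ∧ l ≤ 2 ∧ ∃ (s : Literature.NumberTheory.Transcendental.KZ.IntegralRep k) (s' : Literature.NumberTheory.Transcendental.KZ.IntegralRep l), s.IsRational ∧ s'.IsRational ∧ s.value = s'.value ∧ Literature.NumberTheory.Transcendental.KZ.of r - Literature.NumberTheory.Transcendental.KZ.of r' - (Literature.NumberTheory.Transcendental.KZ.of s - Literature.NumberTheory.Transcendental.KZ.of s') ∈ Literature.NumberTheory.Transcendental.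KZ.relations

/-- item stmt-KontsevichZagierPeriods-23650 · assembly · rank 1 · open · by planner
sources: KontsevichZagier2001
[assembly] PlanarAreas → AreaDescentTwo → KernelDescentTwo → KontsevichZagierPeriods (three
additions in the move group). -/
@[route_item "route-KontsevichZagierPeriods-RootDecompDescentLadder"]
def Assembly : Prop :=
  PlanarAreas → AreaDescentTwo → KernelDescentTwo → KontsevichZagierPeriods

/-! D-0027 §2.1 — DECIDING THEOREM (planner-authored via `route open/edit --closes-file`; by planner-decomp-kz-writer-1-g0-0 2026-08-30T01:26:17Z):
its hypotheses are this route's items and its conclusion the sub-problem Statement (glue_lint), and it elaborates with this file. -/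

@[closes "route-KontsevichZagierPeriods-RootDecompDescentLadder"] theorem closes (h₁ : PlanarAreas) (h₂ : AreaDescentTwo) (h₃ : KernelDescentTwo) :
    _root_.KontsevichZagierPeriods := by
  rw [KontsevichZagierPeriods_iff]
  intro n m r r' hr hr' hv
  obtain ⟨k, l, hk, hl, s, s', hs, hs', hsv, hd⟩ := h₃ r r' hr hr' hv
  obtain ⟨A, A', hA, hA', hAv, hd'⟩ := h₂ hk hl s s' hs hs' hsv
  have hAA := h₁ A A' hA hA' hAv
  have key := Literature.NumberTheory.Transcendental.KZ.relations.add_mem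
    (Literature.NumberTheory.Transcendental.KZ.relations.add_mem hd hd') hAA
  show Literature.NumberTheory.Transcendental.KZ.of r - Literature.NumberTheory.Transcendental.KZ.of r' ∈
    Literature.NumberTheory.Transcendental.KZ.relations
  convert key using 1
  abel

end Summit.KontsevichZagierPeriods.KontsevichZagierPeriods.Theses.RootDecompDescentLadder
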